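import Mathlib
import Literature.Computability.AlgebraicComplexity.MS21DenseOrbitsHittingSets
import HarnessLib

/-!
# Medini–Shpilka 2021, Thm 42 (strictness `ΣΠ^{GLaff} ⊊ ΣΠΣ`), part 1: the witness family
# `e_k(x_1², …, x_n²)` lies in `ΣΠΣ` (Ben-Or interpolation with AFFINE factors)

Towards the named fact `MS2021_thm_42_strict` of
`Literature/Computability/AlgebraicComplexity/MS21DenseOrbitsHittingSets.lean` (cell `val-lit`, row
X6-MS21; CCC 2021 LIPIcs 200:19 Thm 42 = arXiv:2102.05632 Thm 1.26, "for fields of size `|F| ≥ n+1`,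
`ΣΠ^{GLaff}(F) ⊊ ΣΠΣ(F)`"). The PRINTED witness is the elementary symmetric polynomial `σ_d` with
Nisan–Wigderson's partial-derivative lower bound (arXiv p0034:L20-L26), whose formalisation needs the
full-rank theorem for set-disjointness matrices over the field (Gottlieb/Wilson; not in the tree). This
file and its sequel (`MS21SigmaPiAffStrictProofs.lean`) prove instead the slice `char F ≠ 2` of the
statement with a DIFFERENT, derivative-free witness (disclosed deviation; the named fact is NOT
discharged as typed — characteristic `2` remains open in the tree):

  `W_{n,k} := e_k(x_1², …, x_n²) = ∑_{|T| = k} ∏_{i ∈ T} x_i²`.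

Here: `W_{n,k} ∈ Σ^{[n+1]}Π^{[2n+1]}Σ` over every infinite field — Ben-Or's interpolation
`∏_i (x_i² + t) = ∑_T (∏_{i∈T} x_i²) t^{n-|T|}` (`Finset.prod_add`) at `n+1` distinct values
`t_j = -r_j²` (distinct squares exist in an infinite field, `exists_neg_sq_injective`), with the
Lagrange/Vandermonde coefficients `c` of `exists_interpolation_coeffs`, and the AFFINE factorisation
`x_i² - r_j² = (x_i - r_j)(x_i + r_j)` (`isSPS_witness`); also `deg W_{n,k} ≤ 2k`
(`totalDegree_witness_le`).

Theorem-only file (no definitions, no new named fact); `VP ≠ VNP` is NOT proved and nothing here bears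
on it.

## References
* [MediniShpilka2021] D. Medini, A. Shpilka, CCC 2021, LIPIcs 200:19, Thm 42 (= arXiv:2102.05632
  Thm 1.26, p0008:L70-L72; proof §6, p0034:L10-L26).
* M. Ben-Or (cf. Shpilka–Wigderson 2001; Nisan–Wigderson 1996 §1): depth-3 circuits for the
  elementary symmetric polynomials by interpolation.
-/

noncomputable section

open MvPolynomial Matrix

namespace Literature.Computability.AlgebraicComplexity

namespace MS2021

namespace Thm42Strict

variable {K : Type*} [Field K]

/-! ### Interpolation coefficients (Vandermonde) -/

/-- Lagrange coefficients: for `N` distinct nodes `a_j` and a target exponent `e₀ < N` there are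
`c_j` with `∑_j c_j a_j^e = [e = e₀]` for all `e < N` (invert the Vandermonde matrix).
[cite: MediniShpilka2021, §6 proof of Thm 42 (arXiv p0034:L24-L26, "obtained by interpolating")] -/
theorem exists_interpolation_coeffs {N : ℕ} (a : Fin N → K) (ha : Function.Injective a) (e₀ : Fin N) :
    ∃ c : Fin N → K, ∀ e : Fin N, ∑ j, c j * a j ^ (e : ℕ) = if e = e₀ then 1 else 0 := by
  classical
  have hV : IsUnit (Matrix.vandermonde a).det :=
    isUnit_iff_ne_zero.mpr (Matrix.det_vandermonde_ne_zero_iff.mpr ha)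
  refine ⟨Matrix.vecMul (Pi.single e₀ 1) (Matrix.vandermonde a)⁻¹, fun e => ?_⟩
  have h := congrFun (Matrix.vecMul_vecMul (Pi.single e₀ (1 : K)) (Matrix.vandermonde a)⁻¹
    (Matrix.vandermonde a)) e
  rw [Matrix.nonsing_inv_mul _ hV, Matrix.vecMul_one, Pi.single_apply] at h
  rw [← h]
  simp [Matrix.vecMul, dotProduct, Matrix.vandermonde_apply]

/-! ### Distinct squares in an infinite field -/

/-- An infinite field has `N` elements with pairwise distinct squares (each fibre of `x ↦ x²` has at
most two points), hence `N` pairwise distinct values `-r_j²`. [folklore] -/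
private theorem exists_neg_sq_injective [Infinite K] (N : ℕ) :
    ∃ r : Fin N → K, Function.Injective (fun j => -(r j ^ 2)) := by
  classical
  have hinf : (Set.range fun x : K => x ^ 2).Infinite := by
    intro hfin
    have hcov : (Set.univ : Set K) ⊆ ⋃ s ∈ Set.range (fun x : K => x ^ 2), {x : K | x ^ 2 = s} := by
      intro x _
      simp only [Set.mem_iUnion, Set.mem_range, Set.mem_setOf_eq, exists_prop]
      exact ⟨x ^ 2, ⟨x, rfl⟩, rfl⟩
    refine Set.infinite_univ (α := K) ?_
    exact (hfin.biUnion fun s hs => by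
        obtain ⟨x₀, rfl⟩ := hs
        refine (Set.toFinite ({x₀, -x₀} : Set K)).subset fun x hx => ?_
        rcases sq_eq_sq_iff_eq_or_eq_neg.mp hx with h | h
        · exact Or.inl h
        · exact Or.inr h).subset hcov
  let emb := hinf.natEmbedding
  have hsq : ∀ j : Fin N, ∃ r : K, r ^ 2 = (emb j : K) := fun j => by
    obtain ⟨x, hx⟩ := (emb j).2
    exact ⟨x, hx⟩
  choose r hr using hsq
  refine ⟨r, fun j j' hjj' => ?_⟩
  have h1 : (emb j : K) = emb j' := by
    have h0 : r j ^ 2 = r j' ^ 2 := neg_injective hjj'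
    rw [hr, hr] at h0
    exact h0
  exact Fin.ext (emb.injective (Subtype.ext h1))

/-! ### Ben-Or's identity with affine factors -/

/-- `∏_i (x_i² + t) = ∑_{T ⊆ [n]} (∏_{i ∈ T} x_i²) · t^{n - |T|}`. [cite: MediniShpilka2021, §6 proof of Thm 42 (interpolation of ∏ (Y + x_i); arXiv p0034:L24-L26)] -/
theorem prod_X_sq_add_C {n : ℕ} (t : K) :
    ∏ i : Fin n, ((X i : MvPolynomial (Fin n) K) ^ 2 + C t) =
      ∑ T ∈ (Finset.univ : Finset (Fin n)).powerset,
        (∏ i ∈ T, (X i : MvPolynomial (Fin n) K) ^ 2) * C (t ^ (n - T.card)) := by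
  classical
  rw [Finset.prod_add]
  refine Finset.sum_congr rfl fun T hT => ?_
  rw [Finset.prod_const, Finset.card_sdiff_of_subset (Finset.mem_powerset.mp hT), Finset.card_univ,
    Fintype.card_fin, C_pow]

/-- The interpolated sum: with Lagrange coefficients for the exponent `n - k`,
`∑_j c_j ∏_i (x_i² + t_j) = e_k(x_1², …, x_n²)`. [cite: MediniShpilka2021, §6 proof of Thm 42 (arXiv p0034:L24-L26)] -/
theorem sum_C_mul_prod_X_sq_add_C {n k : ℕ} (hk : k ≤ n) (t c : Fin (n + 1) → K)
    (hc : ∀ e : Fin (n + 1), ∑ j, c j * t j ^ (e : ℕ) = if e = ⟨n - k, by omega⟩ then 1 else 0) :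
    ∑ j : Fin (n + 1), C (c j) * ∏ i : Fin n, ((X i : MvPolynomial (Fin n) K) ^ 2 + C (t j)) =
      ∑ T ∈ (Finset.univ : Finset (Fin n)).powersetCard k,
        ∏ i ∈ T, (X i : MvPolynomial (Fin n) K) ^ 2 := by
  classical
  simp_rw [prod_X_sq_add_C, Finset.mul_sum]
  rw [Finset.sum_comm]
  have key : ∀ T ∈ (Finset.univ : Finset (Fin n)).powerset,
      ∑ j : Fin (n + 1), C (c j) * ((∏ i ∈ T, (X i : MvPolynomial (Fin n) K) ^ 2) *
        C (t j ^ (n - T.card))) =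
      if T.card = k then ∏ i ∈ T, (X i : MvPolynomial (Fin n) K) ^ 2 else 0 := by
    intro T hT
    have hTn : T.card ≤ n := by
      simpa using Finset.card_le_card (Finset.mem_powerset.mp hT)
    have hsum : ∑ j : Fin (n + 1), C (c j) * ((∏ i ∈ T, (X i : MvPolynomial (Fin n) K) ^ 2) *
        C (t j ^ (n - T.card))) =
        (∏ i ∈ T, (X i : MvPolynomial (Fin n) K) ^ 2) *
          C (∑ j : Fin (n + 1), c j * t j ^ (n - T.card)) := by
      rw [map_sum, Finset.mul_sum]
      refine Finset.sum_congr rfl fun j _ => ?_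
      rw [map_mul]
      ring
    rw [hsum]
    have hc' := hc ⟨n - T.card, by omega⟩
    simp only [Fin.mk.injEq] at hc'
    rw [hc']
    by_cases hTk : T.card = k
    · rw [if_pos (by omega), if_pos hTk, map_one, mul_one]
    · rw [if_neg (by omega), if_neg hTk, map_zero, mul_zero]
  rw [Finset.sum_congr rfl key, ← Finset.sum_filter, Finset.powersetCard_eq_filter]

/-! ### The affine forms of the `ΣΠΣ` circuit -/

/-- The affine form with coefficient vector "indicator of `i`" and constant `e` is `x_i + e`. [folklore] -/
private theorem affine_form_single {n : ℕ} (i : Fin n) (e : K) :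
    (C e + ∑ m : Fin n, C (if m = i then (1 : K) else 0) * (X m : MvPolynomial (Fin n) K)) =
      X i + C e := by
  classical
  have h : ∀ m : Fin n, C (if m = i then (1 : K) else 0) * (X m : MvPolynomial (Fin n) K) =
      if m = i then X m else 0 := fun m => by
    split_ifs <;> simp
  simp_rw [h]
  rw [Finset.sum_ite_eq' Finset.univ i, if_pos (Finset.mem_univ i), add_comm]

/-- **The witness is a `Σ^{[n+1]}Π^{[2n+1]}Σ` circuit** over every infinite field: product gate `j`
multiplies the `2n` affine forms `x_i - r_j`, `x_i + r_j` and the constant `c_j`.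
[cite: MediniShpilka2021, Thm 42 / §6 (arXiv p0034:L24-L26: ΣΠΣ circuits for symmetric polynomials by interpolation)] -/
theorem isSPS_witness [Infinite K] {n k : ℕ} (hk : k ≤ n) :
    IsSPS (n + 1) (n + n + 1)
      (∑ T ∈ (Finset.univ : Finset (Fin n)).powersetCard k,
        ∏ i ∈ T, (X i : MvPolynomial (Fin n) K) ^ 2) := by
  classical
  obtain ⟨r, hr⟩ := exists_neg_sq_injective (K := K) (n + 1)
  obtain ⟨c, hc⟩ := exists_interpolation_coeffs (fun j => -(r j ^ 2)) hr ⟨n - k, by omega⟩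
  -- the coefficient vectors of the affine forms of product gate `j`
  let α : Fin (n + 1) → Fin (n + n + 1) → Option (Fin n) → K := fun j l =>
    if h : (l : ℕ) < n then fun o => o.elim (-(r j)) fun m => if m = ⟨l, h⟩ then 1 else 0
    else if h' : (l : ℕ) < n + n then
      fun o => o.elim (r j) fun m => if m = ⟨l - n, by omega⟩ then 1 else 0
    else fun o => o.elim (c j) fun _ => 0
  refine ⟨α, ?_⟩
  rw [← sum_C_mul_prod_X_sq_add_C hk (fun j => -(r j ^ 2)) c hc]
  refine Finset.sum_congr rfl fun j _ => ?_
  -- split the `2n + 1` factors into the two blocks of `n` and the last one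
  rw [Fin.prod_univ_add, Fin.prod_univ_add, Fin.prod_univ_one]
  have h1 : ∀ i : Fin n, (C (α j (Fin.castAdd 1 (Fin.castAdd n i)) none) +
      ∑ m : Fin n, C (α j (Fin.castAdd 1 (Fin.castAdd n i)) (some m)) * (X m : MvPolynomial (Fin n) K))
      = X i - C (r j) := by
    intro i
    have hi : ((Fin.castAdd 1 (Fin.castAdd n i) : Fin (n + n + 1)) : ℕ) < n := by simp
    have hα0 : α j (Fin.castAdd 1 (Fin.castAdd n i)) none = -(r j) := by
      simp only [α, dif_pos hi, Option.elim]
    have hα1 : ∀ m : Fin n, α j (Fin.castAdd 1 (Fin.castAdd n i)) (some m) =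
        if m = i then 1 else 0 := by
      intro m
      simp only [α, dif_pos hi, Option.elim]
      simp [Fin.ext_iff]
    simp_rw [hα0, hα1]
    rw [affine_form_single, map_neg, sub_eq_add_neg]
  have h2 : ∀ i : Fin n, (C (α j (Fin.castAdd 1 (Fin.natAdd n i)) none) +
      ∑ m : Fin n, C (α j (Fin.castAdd 1 (Fin.natAdd n i)) (some m)) * (X m : MvPolynomial (Fin n) K))
      = X i + C (r j) := by
    intro i
    have hi : ¬ ((Fin.castAdd 1 (Fin.natAdd n i) : Fin (n + n + 1)) : ℕ) < n := by simp
    have hi' : ((Fin.castAdd 1 (Fin.natAdd n i) : Fin (n + n + 1)) : ℕ) < n + n := by simp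
    have hα0 : α j (Fin.castAdd 1 (Fin.natAdd n i)) none = r j := by
      simp only [α, dif_neg hi, dif_pos hi', Option.elim]
    have hα1 : ∀ m : Fin n, α j (Fin.castAdd 1 (Fin.natAdd n i)) (some m) =
        if m = i then 1 else 0 := by
      intro m
      simp only [α, dif_neg hi, dif_pos hi', Option.elim]
      simp [Fin.ext_iff]
    simp_rw [hα0, hα1]
    rw [affine_form_single]
  have h3 : (C (α j (Fin.natAdd (n + n) (0 : Fin 1)) none) +
      ∑ m : Fin n, C (α j (Fin.natAdd (n + n) (0 : Fin 1)) (some m)) * (X m : MvPolynomial (Fin n) K))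
      = C (c j) := by
    have hi : ¬ ((Fin.natAdd (n + n) (0 : Fin 1) : Fin (n + n + 1)) : ℕ) < n := by simp
    have hi' : ¬ ((Fin.natAdd (n + n) (0 : Fin 1) : Fin (n + n + 1)) : ℕ) < n + n := by simp
    have hα0 : α j (Fin.natAdd (n + n) (0 : Fin 1)) none = c j := by
      simp only [α, dif_neg hi, dif_neg hi', Option.elim]
    have hα1 : ∀ m : Fin n, α j (Fin.natAdd (n + n) (0 : Fin 1)) (some m) = 0 := by
      intro m
      simp only [α, dif_neg hi, dif_neg hi', Option.elim]
    simp_rw [hα0, hα1]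
    simp
  simp_rw [h1, h2]
  rw [h3, ← Finset.prod_mul_distrib, mul_comm]
  congr 1
  refine Finset.prod_congr rfl fun i _ => ?_
  rw [map_neg, C_pow]
  ring

/-! ### Degree of the witness -/

/-- `deg e_k(x_1², …, x_n²) ≤ 2k`. [cite: MediniShpilka2021, Thm 42 / §6 (Claim 6.1: degrees of ΣΠ^{GLaff} members)] -/
theorem totalDegree_witness_le {n k : ℕ} :
    (∑ T ∈ (Finset.univ : Finset (Fin n)).powersetCard k,
      ∏ i ∈ T, (X i : MvPolynomial (Fin n) K) ^ 2).totalDegree ≤ 2 * k := by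
  classical
  refine totalDegree_finsetSum_le fun T hT => (totalDegree_finsetProd _ _).trans ?_
  have hcard : T.card = k := (Finset.mem_powersetCard.mp hT).2
  calc ∑ i ∈ T, ((X i : MvPolynomial (Fin n) K) ^ 2).totalDegree ≤ ∑ _i ∈ T, 2 :=
        Finset.sum_le_sum fun i _ => (totalDegree_pow _ _).trans (by
          rw [totalDegree_X])
    _ = 2 * k := by rw [Finset.sum_const, smul_eq_mul, hcard, mul_comm]

end Thm42Strict

end MS2021

end Literature.Computability.AlgebraicComplexity

end
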